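import Summits.Ventures.HSemireg.HafnianBracketPermanent1
import HarnessLib

/-!
# Venture HSemireg — the hafnian law for permanents of rank-two alternating («bracket») matrices, part 2/2: the double sum, the induction, the law, its instances and the base change

Part of the Lean index of the computation cell `pub-hsemireg` (theory seat th-7 gen 8; tree-shaped draft offered to the
enclosure lane p3 / t-7 / p6).  Builds on the tree's `Literature/Combinatorics/Enumerative/Hafnian.lean` /
`HafnianExpansion.lean` / `HafnianGeneratingFunction.lean` (`hafnian`, `perfectMatchings`, `HafnianExpansion.minor`, the row
expansion of the hafnian, `hafnian_submatrix_equiv`).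

For an ALTERNATING form `b : V → V → R` with values in a commutative ring which satisfies the three-term
(Plücker / Grassmann) relation — `b x x = 0`, `b x y = − b y x`,
`b x y · b z w − b x z · b y w + b x w · b y z = 0` (e.g. `b x y = x − y` on `R`, or the bracket
`[p, q] = p₁ q₂ − p₂ q₁` of two vectors of `R²`, i.e. any matrix `(b (r i) (r j))` of rank ≤ 2) — and points
`r : Fin (2m) → V`, the PERMANENT of the alternating matrix `(b (r i) (r j))_{i,j}` is a multiple of the HAFNIAN of the
matrix of SQUARED entries:

  `per (b (r i) (r j))_{i,j < 2m} = (−1)^m · m! · haf ((b (r i) (r j))²)_{i,j < 2m}`   (`hafnian_law`),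

equivalently (`b x y = x − y`): `per (x_i − x_j) = (−1)^m · m! · Σ_{M} Π_{{i,j} ∈ M} (x_i − x_j)²`, the sum over the
perfect matchings `M` of `{0, …, 2m−1}` (`permanent_sub_eq`); for an odd number of points the permanent vanishes
(`permanent_odd`). The BORDERED versions (rows `(a, r)`, columns `(c, r)`) are `even_bordered` and `odd_bordered`:

  `per = (−1)^j (j+1)! · haf((b (r s) (r t))²) · b a c`                         (`r : Fin (2j) → V`),
  `per = (−1)^j (j+1)! · Σ_i b a (r i) · b (r i) c · haf((b (r s) (r t))²)_{s,t ≠ i}`   (`r : Fin (2j+1) → V`).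

Through the polarisation formula `⟨Π ℓ_i, Π m_j⟩_N = per([ℓ_i, m_j]) / N!` for the apolar pairing of binary forms this is
the classical expression of the quadratic (apolar) invariant of a binary form of even degree `2m` as a symmetric function
of ROOT DIFFERENCES, `⟨f, f⟩_{2m} = (−1)^m (m!/(2m)!) Σ_M Π_{ij ∈ M} (α_i − α_j)²` (for the quartic: `I = (1/24) Σ (α−β)²(γ−δ)²`),
whence the SIGN LAW `(−1)^m ⟨f, f⟩_{2m} ≥ 0` for real-rooted `f`, with equality iff a root has multiplicity `> m`
(that translation is NOT formalised here; this file is about permanents and hafnians only).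

HONEST FRAMING (cell `pub-hsemireg`, theory seat th-7): pure finite combinatorics / commutative algebra; nothing here
bears on HC / HC_CM / HC_AV or on any variety. Used by the cell only through the dictionary above (one-sided W-purity law,
theory/FORMULA-N-th7.md §L.11).

## Contents (all proved, 0 named facts)

* Laplace expansion of `Matrix.permanent` along column `0`: part 1 imports and uses the landed
  `Literature.Analysis.Matrix.perm_laplace_col_zero` (PermanentHadamard.lean; [folklore]) — not re-proved (gate dedup.landed, 2026-08-23).
* `P b p q := per (b (p i) (q j))` (two configurations `p q : Fin k → V`), `Asq b p := ((b (p i) (p j))²)`,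
  `Hf b p := haf (Asq b p)`; `P_laplace`, `P_perm_cols`, `P_cons_cons` (the realigned expansion
  `P(cons a r, cons c r) = b a c · P(r,r) + Σ_i b(r_i, c) · P(cons a r∖i, cons r_i r∖i)`), `P_self`, `P_cons_zero`.
* `Hf_reindex`, `hafnian_minor_Asq`, `hafnian_minor_swap`, `card_compl2`, `emb2` (the increasing enumeration of
  `Fin (k+2) ∖ {i, i.succAbove l}`), `hafnian_minor_succAbove`, `Hf_expand_zero` (row-`0` expansion of `Hf` in
  `succAbove` form), `sum_sum_erase_mul_hafnian_minor` (edge-sum identity `Σ_a Σ_{c ≠ a} A_{ac} haf A_{ac} = n · haf A`).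
* `pair_identity` (`F(i,m) + F(m,i) = − b a c · b(r_i,r_m)² · haf(minor)`, one `linear_combination` with the Plücker
  relation), `two_mul_double_sum` (division-free), `double_sum` (uses `IsLeftRegular 2` once).
* `step_FO`, `step_O`, `step_FE`, `step_E`, `even_bordered`, **`hafnian_law`**, `permanent_odd`, **`odd_bordered`**.
* Instances: `permanent_sub_eq`, `permanent_sub_odd` (`b x y = x − y`), `bracket`, `permanent_bracket_eq`,
  `permanent_sub_bordered_even`, `permanent_sub_bordered_odd`.

Hypothesis `IsLeftRegular (2 : R)` in the abstract statements: the proof halves the symmetrised double sum once; for the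
affine instance `b x y = x − y` it is REMOVED by base change from the universal ring `ℤ[X_0, …, X_{2m−1}]`
(`permanent_sub_eq_all`, `permanent_sub_odd_all`, section `BaseChange`: `map_permanent`, `map_hafnian`).  NOT covered: the
abstract form without the `2`-hypothesis, the refinement by number of cycles (`Σ_{σ with k cycles} = (−1)^m c(m,k) · haf`,
`c` = unsigned Stirling numbers), the apolar dictionary.
-/

namespace Summit.Ventures.HSemireg

open Finset Matrix
open Literature.Combinatorics.Enumerative Literature.Combinatorics.Enumerative.HafnianExpansion
  Literature.Combinatorics.Enumerative.HafnianGeneratingFunction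

namespace BracketPermanent

variable {R : Type*} [CommRing R] {V : Type*} (b : V → V → R)
section DoubleSum

variable {W : Type*} [Fintype W] [DecidableEq W] [LinearOrder W]

omit [LinearOrder W] in
/-- swapping the roles in an off-diagonal double sum. [folklore] -/
theorem sum_erase_swap {M : Type*} [AddCommGroup M] (G : W → W → M) :
    ∑ i, ∑ m ∈ univ.erase i, G m i = ∑ i, ∑ m ∈ univ.erase i, G i m := by
  simp only [Finset.sum_erase_eq_sub (Finset.mem_univ _)]
  rw [Finset.sum_sub_distrib, Finset.sum_sub_distrib, Finset.sum_comm]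

/-- the PAIR IDENTITY (Plücker): `F(i,m) + F(m,i) = − b a c · b(r_i,r_m)² · haf(minor i m)`. [folklore] -/
theorem pair_identity (hanti : ∀ x y, b x y = - b y x)
    (hpl : ∀ x y z w, b x y * b z w - b x z * b y w + b x w * b y z = 0)
    (r : W → V) (a c : V) (i m : W) :
    b (r i) c * b a (r m) * b (r m) (r i) * hafnian (minor (Asq b r) i m) +
      b (r m) c * b a (r i) * b (r i) (r m) * hafnian (minor (Asq b r) m i) =
      -(b a c) * (Asq b r i m * hafnian (minor (Asq b r) i m)) := by
  rw [hafnian_minor_swap b r i m, show Asq b r i m = b (r i) (r m) ^ 2 from rfl,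
    hanti (r m) (r i), hanti (r i) c, hanti (r m) c]
  linear_combination (b (r i) (r m) * hafnian (minor (Asq b r) i m)) * hpl a c (r i) (r m)

/-- TWICE THE DOUBLE SUM of the Laplace step, in closed form (no division used). [folklore] -/
theorem two_mul_double_sum (hanti : ∀ x y, b x y = - b y x)
    (hpl : ∀ x y z w, b x y * b z w - b x z * b y w + b x w * b y z = 0)
    {k : ℕ} (r : Fin (k + 2) → V) (a c : V) :
    2 * ∑ i : Fin (k + 2), ∑ l : Fin (k + 1), b (r i) c * b a (r (i.succAbove l)) *
        b (r (i.succAbove l)) (r i) * Hf b (fun t : Fin k => r (i.succAbove (l.succAbove t))) =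
      -(b a c) * (((k + 2 : ℕ) : R) * Hf b r) := by
  simp only [← hafnian_minor_succAbove]
  have step1 : ∀ i : Fin (k + 2),
      ∑ l : Fin (k + 1), b (r i) c * b a (r (i.succAbove l)) * b (r (i.succAbove l)) (r i) *
          hafnian (minor (Asq b r) i (i.succAbove l)) =
        ∑ m ∈ univ.erase i, b (r i) c * b a (r m) * b (r m) (r i) *
          hafnian (minor (Asq b r) i m) := fun i =>
    (sum_erase_eq_sum_succAbove (fun m => b (r i) c * b a (r m) * b (r m) (r i) *
      hafnian (minor (Asq b r) i m)) i).symm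
  simp only [step1]
  rw [two_mul]
  nth_rewrite 1 [← sum_erase_swap (fun i m => b (r i) c * b a (r m) * b (r m) (r i) *
    hafnian (minor (Asq b r) i m))]
  rw [← Finset.sum_add_distrib]
  simp only [← Finset.sum_add_distrib]
  have step4 : ∀ i : Fin (k + 2), ∑ m ∈ univ.erase i,
      (b (r m) c * b a (r i) * b (r i) (r m) * hafnian (minor (Asq b r) m i) +
        b (r i) c * b a (r m) * b (r m) (r i) * hafnian (minor (Asq b r) i m)) =
      ∑ m ∈ univ.erase i, -(b a c) * (Asq b r i m * hafnian (minor (Asq b r) i m)) := fun i => by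
    refine Finset.sum_congr rfl fun m _ => ?_
    rw [add_comm]
    exact pair_identity b hanti hpl r a c i m
  simp only [step4, ← Finset.mul_sum]
  rw [sum_sum_erase_mul_hafnian_minor b hanti r, Fintype.card_fin]

/-- the DOUBLE SUM itself, when `2` is cancellable, for an even number `2j+2` of points. [folklore] -/
theorem double_sum (hanti : ∀ x y, b x y = - b y x)
    (hpl : ∀ x y z w, b x y * b z w - b x z * b y w + b x w * b y z = 0)
    (h2 : IsLeftRegular (2 : R)) {j : ℕ} (r : Fin (2 * j + 2) → V) (a c : V) :
    ∑ i : Fin (2 * j + 2), ∑ l : Fin (2 * j + 1), b (r i) c * b a (r (i.succAbove l)) *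
        b (r (i.succAbove l)) (r i) * Hf b (fun t : Fin (2 * j) => r (i.succAbove (l.succAbove t))) =
      -(b a c) * (((j + 1 : ℕ) : R) * Hf b r) := by
  apply h2
  show 2 * _ = 2 * _
  rw [two_mul_double_sum b hanti hpl r a c]
  push_cast
  ring

end DoubleSum

section Main

variable (hd : ∀ x, b x x = 0) (hanti : ∀ x y, b x y = - b y x)
  (hpl : ∀ x y z w, b x y * b z w - b x z * b y w + b x w * b y z = 0)
  (h2 : IsLeftRegular (2 : R))

include hd in
/-- odd self-permanents vanish, given the even bordered law at size `2j`. [folklore] -/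
theorem step_FO (j : ℕ)
    (hG : ∀ (r : Fin (2 * j) → V) (a c : V), P b (Fin.cons a r) (Fin.cons c r) =
      (-1) ^ j * ((j + 1).factorial : R) * Hf b r * b a c)
    (r : Fin (2 * j + 1) → V) : P b r r = 0 := by
  rw [P_self, hG, hd, mul_zero]

include hd in
/-- the ODD bordered law at size `2j+1`, from the even one at size `2j`. [folklore] -/
theorem step_O (j : ℕ)
    (hG : ∀ (r : Fin (2 * j) → V) (a c : V), P b (Fin.cons a r) (Fin.cons c r) =
      (-1) ^ j * ((j + 1).factorial : R) * Hf b r * b a c)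
    (r : Fin (2 * j + 1) → V) (a c : V) :
    P b (Fin.cons a r) (Fin.cons c r) = (-1) ^ j * ((j + 1).factorial : R) *
      ∑ i : Fin (2 * j + 1), b a (r i) * b (r i) c * Hf b (r ∘ i.succAbove) := by
  rw [P_cons_cons, step_FO b hd j hG r, mul_zero, zero_add, Finset.mul_sum]
  refine Finset.sum_congr rfl fun i _ => ?_
  rw [hG (r ∘ i.succAbove) a (r i)]
  ring

include hd hanti in
/-- the EVEN self-permanent at size `2j+2`, from the even bordered law at size `2j`. [folklore] -/
theorem step_FE (j : ℕ)
    (hG : ∀ (r : Fin (2 * j) → V) (a c : V), P b (Fin.cons a r) (Fin.cons c r) =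
      (-1) ^ j * ((j + 1).factorial : R) * Hf b r * b a c)
    (r : Fin (2 * j + 2) → V) :
    P b r r = (-1) ^ (j + 1) * ((j + 1).factorial : R) * Hf b r := by
  rw [P_self, P_cons_cons, step_FO b hd j hG (r ∘ Fin.succ), mul_zero, zero_add, Hf_expand_zero,
    Finset.mul_sum]
  refine Finset.sum_congr rfl fun i _ => ?_
  rw [hG ((r ∘ Fin.succ) ∘ i.succAbove) (r 0) ((r ∘ Fin.succ) i)]
  simp only [Function.comp_apply, Function.comp_def]
  rw [hanti (r i.succ) (r 0)]
  ring

include hd hanti hpl h2 in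
/-- the EVEN bordered law at size `2j+2`, from the one at size `2j`. [folklore] -/
theorem step_E (j : ℕ)
    (hG : ∀ (r : Fin (2 * j) → V) (a c : V), P b (Fin.cons a r) (Fin.cons c r) =
      (-1) ^ j * ((j + 1).factorial : R) * Hf b r * b a c)
    (r : Fin (2 * j + 2) → V) (a c : V) :
    P b (Fin.cons a r) (Fin.cons c r) =
      (-1) ^ (j + 1) * ((j + 2).factorial : R) * Hf b r * b a c := by
  rw [P_cons_cons, step_FE b hd hanti j hG r]
  have hO : ∀ i : Fin (2 * j + 2),
      b (r i) c * P b (Fin.cons a (r ∘ i.succAbove)) (Fin.cons (r i) (r ∘ i.succAbove)) =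
      (-1) ^ j * ((j + 1).factorial : R) * ∑ l : Fin (2 * j + 1), b (r i) c *
        b a (r (i.succAbove l)) * b (r (i.succAbove l)) (r i) *
          Hf b (fun t : Fin (2 * j) => r (i.succAbove (l.succAbove t))) := fun i => by
    rw [step_O b hd j hG (r ∘ i.succAbove) a (r i), Finset.mul_sum, Finset.mul_sum, Finset.mul_sum]
    refine Finset.sum_congr rfl fun l _ => ?_
    simp only [Function.comp_apply, Function.comp_def]
    ring
  simp only [hO, ← Finset.mul_sum]
  rw [double_sum b hanti hpl h2 r a c]
  push_cast [Nat.factorial_succ]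
  ring

include hd hanti hpl h2 in
/-- **THE EVEN BORDERED LAW** at every size `2j`. [folklore] -/
theorem even_bordered : ∀ (j : ℕ) (r : Fin (2 * j) → V) (a c : V),
    P b (Fin.cons a r) (Fin.cons c r) = (-1) ^ j * ((j + 1).factorial : R) * Hf b r * b a c := by
  intro j
  induction j with
  | zero =>
    intro r a c
    rw [P_cons_zero]
    have hr : Hf b r = 1 := by
      haveI : IsEmpty (Fin (2 * 0)) := inferInstanceAs (IsEmpty (Fin 0))
      unfold Hf
      exact hafnian_of_isEmpty _
    rw [hr]
    simp
  | succ j ih =>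
    intro r a c
    exact step_E b hd hanti hpl h2 j ih r a c

include hd hanti hpl h2 in
/-- **THE HAFNIAN LAW**: `per (b (r i) (r j))_{2m} = (-1)^m · m! · haf (b (r i) (r j)^2)`. [folklore] -/
theorem hafnian_law (m : ℕ) (r : Fin (2 * m) → V) :
    P b r r = (-1) ^ m * (m.factorial : R) * Hf b r := by
  cases m with
  | zero =>
    haveI : IsEmpty (Fin (2 * 0)) := inferInstanceAs (IsEmpty (Fin 0))
    unfold P Hf
    rw [Matrix.permanent_isEmpty, hafnian_of_isEmpty]
    simp
  | succ j => exact step_FE b hd hanti j (even_bordered b hd hanti hpl h2 j) r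

include hd hanti hpl h2 in
/-- odd sizes: the bracket permanent vanishes. [folklore] -/
theorem permanent_odd (j : ℕ) (r : Fin (2 * j + 1) → V) : P b r r = 0 :=
  step_FO b hd j (even_bordered b hd hanti hpl h2 j) r

include hd hanti hpl h2 in
/-- **THE ODD COMPANION** (bordered permanent at odd size `2j+1`). [folklore] -/
theorem odd_bordered (j : ℕ) (r : Fin (2 * j + 1) → V) (a c : V) :
    P b (Fin.cons a r) (Fin.cons c r) = (-1) ^ j * ((j + 1).factorial : R) *
      ∑ i : Fin (2 * j + 1), b a (r i) * b (r i) c * Hf b (r ∘ i.succAbove) :=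
  step_O b hd j (even_bordered b hd hanti hpl h2 j) r a c

end Main

section Corollaries

/-- **HAFNIAN LAW, affine form**: `per (x_i − x_j)_{2m} = (−1)^m · m! · haf ((x_i − x_j)²)` in any commutative
ring in which `2` is (left-)regular. [folklore] -/
theorem permanent_sub_eq (h2 : IsLeftRegular (2 : R)) (m : ℕ) (x : Fin (2 * m) → R) :
    (Matrix.of fun i j => x i - x j).permanent =
      (-1) ^ m * (m.factorial : R) * hafnian (Matrix.of fun i j => (x i - x j) ^ 2) :=
  hafnian_law (fun u v : R => u - v) (fun u => sub_self u) (fun u v => (neg_sub v u).symm)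
    (fun u v z w => by ring) h2 m x

/-- odd sizes: `per (x_i − x_j)_{2j+1} = 0`. [folklore] -/
theorem permanent_sub_odd (h2 : IsLeftRegular (2 : R)) (j : ℕ) (x : Fin (2 * j + 1) → R) :
    (Matrix.of fun i l => x i - x l).permanent = 0 :=
  permanent_odd (fun u v : R => u - v) (fun u => sub_self u) (fun u v => (neg_sub v u).symm)
    (fun u v z w => by ring) h2 j x

/-- the bracket `[p, q] = p₁ q₂ − p₂ q₁` on `R²`. [folklore] -/
def bracket (p q : R × R) : R := p.1 * q.2 - p.2 * q.1

/-- **HAFNIAN LAW for brackets of points of `R²`** (the projective form):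
`per ([p_i, p_j])_{2m} = (−1)^m · m! · haf ([p_i, p_j]²)`. [folklore] -/
theorem permanent_bracket_eq (h2 : IsLeftRegular (2 : R)) (m : ℕ) (p : Fin (2 * m) → R × R) :
    (Matrix.of fun i j => bracket (p i) (p j)).permanent =
      (-1) ^ m * (m.factorial : R) * hafnian (Matrix.of fun i j => bracket (p i) (p j) ^ 2) :=
  hafnian_law bracket (fun u => by simp [bracket, mul_comm]) (fun u v => by unfold bracket; ring)
    (fun u v z w => by unfold bracket; ring) h2 m p

/-- **ODD COMPANION for brackets**: the bordered permanent with rows `(a, p)` and columns `(c, p)`,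
`p : Fin (2j+1) → R²`… — stated in the `P` vocabulary: see `odd_bordered`; affine instance: [folklore] -/
theorem permanent_sub_bordered_odd (h2 : IsLeftRegular (2 : R)) (j : ℕ) (x : Fin (2 * j + 1) → R)
    (a c : R) :
    (Matrix.of fun i l => (Fin.cons a x : Fin (2 * j + 2) → R) i - (Fin.cons c x : Fin (2 * j + 2) → R) l).permanent =
      (-1) ^ j * ((j + 1).factorial : R) *
        ∑ i : Fin (2 * j + 1), (a - x i) * (x i - c) *
          hafnian (Matrix.of fun s t : Fin (2 * j) => (x (i.succAbove s) - x (i.succAbove t)) ^ 2) :=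
  odd_bordered (fun u v : R => u - v) (fun u => sub_self u) (fun u v => (neg_sub v u).symm)
    (fun u v z w => by ring) h2 j x a c

/-- **EVEN BORDERED LAW, affine form**: rows `(a, x)`, columns `(c, x)`, `x : Fin (2j) → R`:
`per = (−1)^j (j+1)! · haf((x_s − x_t)²) · (a − c)`. [folklore] -/
theorem permanent_sub_bordered_even (h2 : IsLeftRegular (2 : R)) (j : ℕ) (x : Fin (2 * j) → R)
    (a c : R) :
    (Matrix.of fun i l => (Fin.cons a x : Fin (2 * j + 1) → R) i - (Fin.cons c x : Fin (2 * j + 1) → R) l).permanent =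
      (-1) ^ j * ((j + 1).factorial : R) *
        hafnian (Matrix.of fun s t : Fin (2 * j) => (x s - x t) ^ 2) * (a - c) :=
  even_bordered (fun u v : R => u - v) (fun u => sub_self u) (fun u v => (neg_sub v u).symm)
    (fun u v z w => by ring) h2 j x a c

end Corollaries


section BaseChange

/-- a ring hom maps permanents to permanents. [folklore] -/
theorem map_permanent {S T : Type*} [CommRing S] [CommRing T] (φ : S →+* T) {n : Type*} [Fintype n]
    [DecidableEq n] (M : Matrix n n S) : φ M.permanent = (M.map φ).permanent := by
  simp only [Matrix.permanent, map_sum, map_prod, Matrix.map_apply]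

/-- a ring hom maps hafnians to hafnians. [folklore] -/
theorem map_hafnian {S T : Type*} [CommRing S] [CommRing T] (φ : S →+* T) {W : Type*} [Fintype W]
    [DecidableEq W] [LinearOrder W] (A : Matrix W W S) : φ (hafnian A) = hafnian (A.map φ) := by
  simp only [hafnian, map_sum, map_prod, Matrix.map_apply]

/-- **HAFNIAN LAW, affine form, in EVERY commutative ring** (no hypothesis on `2`): base change of the
universal identity in `ℤ[X_0, …, X_{2m−1}]` (a domain of characteristic `0`). [folklore] -/
theorem permanent_sub_eq_all (m : ℕ) (x : Fin (2 * m) → R) :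
    (Matrix.of fun i j => x i - x j).permanent =
      (-1) ^ m * (m.factorial : R) * hafnian (Matrix.of fun i j => (x i - x j) ^ 2) := by
  -- the universal identity
  have h2 : IsLeftRegular (2 : MvPolynomial (Fin (2 * m)) ℤ) :=
    (IsRegular.of_ne_zero two_ne_zero).left
  have huniv := permanent_sub_eq h2 m (fun i => (MvPolynomial.X i : MvPolynomial (Fin (2 * m)) ℤ))
  -- base change along the evaluation hom
  let φ : MvPolynomial (Fin (2 * m)) ℤ →+* R := MvPolynomial.eval₂Hom (Int.castRingHom R) x
  have hφ := congrArg φ huniv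
  rw [map_permanent, map_mul, map_mul, map_hafnian, map_pow, map_neg, map_one, map_natCast] at hφ
  have hM : (Matrix.of fun i j => (MvPolynomial.X i : MvPolynomial (Fin (2 * m)) ℤ) - MvPolynomial.X j).map φ =
      Matrix.of fun i j => x i - x j := by
    ext i j
    simp [φ]
  have hA : (Matrix.of fun i j =>
      ((MvPolynomial.X i : MvPolynomial (Fin (2 * m)) ℤ) - MvPolynomial.X j) ^ 2).map φ =
      Matrix.of fun i j => (x i - x j) ^ 2 := by
    ext i j
    simp [φ]
  rw [hM, hA] at hφ
  exact hφ

/-- odd sizes, every commutative ring. [folklore] -/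
theorem permanent_sub_odd_all (j : ℕ) (x : Fin (2 * j + 1) → R) :
    (Matrix.of fun i l => x i - x l).permanent = 0 := by
  have h2 : IsLeftRegular (2 : MvPolynomial (Fin (2 * j + 1)) ℤ) :=
    (IsRegular.of_ne_zero two_ne_zero).left
  have huniv := permanent_sub_odd h2 j (fun i => (MvPolynomial.X i : MvPolynomial (Fin (2 * j + 1)) ℤ))
  let φ : MvPolynomial (Fin (2 * j + 1)) ℤ →+* R := MvPolynomial.eval₂Hom (Int.castRingHom R) x
  have hφ := congrArg φ huniv
  rw [map_permanent, map_zero] at hφ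
  have hM : (Matrix.of fun i l => (MvPolynomial.X i : MvPolynomial (Fin (2 * j + 1)) ℤ) - MvPolynomial.X l).map φ =
      Matrix.of fun i l => x i - x l := by
    ext i l
    simp [φ]
  rw [hM] at hφ
  exact hφ

end BaseChange

end BracketPermanent

end Summit.Ventures.HSemireg
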